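import Summits.CriticalPhenomena.PercolationContinuityZ3.Theorems.PercNearOneGluingNoHeavyLowerTailJointLemma3
import HarnessLib

/-!
# `NoHeavyLowerTail` (stmt-CriticalPhenomena-4575) — joint Lemma 3 with the SHARP error term `δ·μ(Q ∩ D)/μ(D)`

Support file (lemma factory `prim-lf-7`, conditional association, gen 10; `--supports stmt-CriticalPhenomena-4575`).
No definitions, no named facts, no sorries.  Companion of `…NoHeavyLowerTailJointLemma3.lean` (gen 7).

`JointLemma3.lemma3_joint` transfers `μ(a₁ ↔ b) ≤ μ(a₂ ↔ b) + δ` to `μ(a₁ ↔ b, Q) ≤ μ(a₂ ↔ b, Q) + δ` for every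
event `Q = {(C_{a₂}, C_{a₁}) ∈ 𝒬}` increasing in the open edge cluster of `a₂` and decreasing in that of `a₁`
(van den Berg–Häggström–Kahn 2006 Thm. 1.5 used twice on `D = {a₂ ↮ a₁}`).  Its proof in fact gives the error
`δ · μ(Q ∩ D) / μ(D)` — the chain is `μ(D)μ(D, a₁↔b, Q) ≤ μ(D, a₁↔b)μ(D, Q) ≤ (μ(D, a₂↔b) + δ)μ(D, Q)
≤ μ(D)μ(D, a₂↔b, Q) + δμ(D, Q)` — and the printed argument then bounds `μ(Q ∩ D)/μ(D)` by `1`.  For ONE-SIDED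
(increasing) `Q` Kozma–Nitzan's sharp form `+ δ·μ(Q)` (`knLemma3i`) follows by Harris (`μ(Q ∩ D) ≤ μ(Q)μ(D)`);
for joint up/down events Harris is unavailable, but the quotient form is exactly what the ε-sprinkling proof of the
ANCHORED exchange needs (`…NoHeavyLowerTailUpsetExchangeJoint.lean`: there `Q ⊆ {S internally open}` and
`μ_{w_ε}(D, S internally open) ≤ μ_{w_ε}(S internally open)·μ_{w_ε}(D)` because `D` is decreasing).

* `JointLemma3.lemma3_joint_sharp` — family form;  `JointLemma3.lemma3_joint_event` — pointwise-monotone event form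
  (the interface of `knLemma3i`).
-/

noncomputable section

namespace Summit.CriticalPhenomena.PercolationContinuityZ3.Theorems

open MeasureTheory Set
open Literature.Probability.LatticeModels
open Literature.Probability.Percolation Literature.Probability.Percolation.KNPreFKG

open Classical

namespace JointLemma3

variable {V : Type*} [Fintype V]

/-- **Joint Lemma 3, sharp error term.**  If `μ(a₁ ↔ b) ≤ μ(a₂ ↔ b) + δ` (`δ ≥ 0`) then for every event
`Q = {(C_{a₂}, C_{a₁}) ∈ 𝒬}` with `𝒬` increasing in the first and decreasing in the second coordinate,
`μ(a₁ ↔ b, Q) ≤ μ(a₂ ↔ b, Q) + δ · μ(Q, a₂ ↮ a₁) / μ(a₂ ↮ a₁)` (the quotient read as `0` when `μ(a₂ ↮ a₁) = 0`).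
Same proof as `lemma3_joint` (BHK Thm. 1.5 twice on `D = {a₂ ↮ a₁}`), keeping the factor `μ(Q ∩ D)/μ(D)` that the
printed argument bounds by `1`.
[cite: KozmaNitzan2024, Lemma 3 (pp. 6–7)] [cite: VandenbergHaggstromKahn2005, Thm. 1.5 (p. 7)] -/
theorem lemma3_joint_sharp (w : Sym2 V → unitInterval) (a₁ a₂ b : V) {δ : ℝ} (hδ : 0 ≤ δ)
    (h : (prodBernoulli w).real (openConn a₁ b) ≤ (prodBernoulli w).real (openConn a₂ b) + δ)
    {𝒬 : Set (Set (Sym2 V) × (Set (Sym2 V))ᵒᵈ)} (h𝒬 : IsUpperSet 𝒬) :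
    (prodBernoulli w).real (openConn a₁ b ∩
        {ω : BondConfig V | (openEdgeCluster ω a₂, OrderDual.toDual (openEdgeCluster ω a₁)) ∈ 𝒬}) ≤
      (prodBernoulli w).real (openConn a₂ b ∩
        {ω : BondConfig V | (openEdgeCluster ω a₂, OrderDual.toDual (openEdgeCluster ω a₁)) ∈ 𝒬}) +
        δ * ((prodBernoulli w).real ({ω : BondConfig V | ¬ (openGraph ω).Reachable a₂ a₁} ∩
              {ω : BondConfig V | (openEdgeCluster ω a₂, OrderDual.toDual (openEdgeCluster ω a₁)) ∈ 𝒬}) /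
            (prodBernoulli w).real {ω : BondConfig V | ¬ (openGraph ω).Reachable a₂ a₁}) := by
  classical
  set μ := prodBernoulli w with hμ
  set X₁ : Set (BondConfig V) := openConn a₁ b with hX₁
  set X₂ : Set (BondConfig V) := openConn a₂ b with hX₂
  set Q : Set (BondConfig V) :=
    {ω : BondConfig V | (openEdgeCluster ω a₂, OrderDual.toDual (openEdgeCluster ω a₁)) ∈ 𝒬} with hQ
  set D : Set (BondConfig V) := {ω | ¬ (openGraph ω).Reachable a₂ a₁} with hD
  have hquot : 0 ≤ μ.real (D ∩ Q) / μ.real D := div_nonneg measureReal_nonneg measureReal_nonneg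
  by_cases h12 : a₁ = a₂
  · subst h12
    exact le_add_of_nonneg_right (mul_nonneg hδ hquot)
  -- on `Dᶜ` the two connection events agree
  have hagree : X₁ ∩ Dᶜ = X₂ ∩ Dᶜ := by
    ext ω
    simp only [mem_inter_iff, mem_compl_iff, mem_setOf_eq, not_not, hX₁, hX₂, hD, openConn]
    constructor
    · rintro ⟨h1, h2⟩
      exact ⟨h2.trans h1, h2⟩
    · rintro ⟨h1, h2⟩
      exact ⟨h2.symm.trans h1, h2⟩
  have hsplit : ∀ A : Set (BondConfig V), μ.real A = μ.real (A ∩ D) + μ.real (A ∩ Dᶜ) := by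
    intro A
    rw [← measureReal_inter_add_sdiff (s := A) (MeasurableSet.of_discrete : MeasurableSet D), Set.sdiff_eq]
  -- the hypothesis restricted to `D`
  have hH : μ.real (D ∩ X₁) ≤ μ.real (D ∩ X₂) + δ := by
    have h' := h
    rw [hsplit X₁, hsplit X₂, hagree] at h'
    rw [inter_comm D X₁, inter_comm D X₂]
    linarith
  -- `1{a₁ ↔ b}` is negatively, `1{a₂ ↔ b}` positively correlated with `1_Q` given `D`
  have h1 := neg_corr_right w a₂ a₁ (Ne.symm h12) (isUpperSet_connFamily a₁ b) h𝒬
  rw [← openConn_eq_setOf_connFamily] at h1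
  have h3 := pos_corr_left w a₂ a₁ (Ne.symm h12) (isUpperSet_connFamily a₂ b) h𝒬
  rw [← openConn_eq_setOf_connFamily] at h3
  have hcore : μ.real (X₁ ∩ Q ∩ D) ≤ μ.real (X₂ ∩ Q ∩ D) + δ * (μ.real (D ∩ Q) / μ.real D) := by
    rw [inter_comm (X₁ ∩ Q) D, inter_comm (X₂ ∩ Q) D]
    by_cases hD0 : μ.real D = 0
    · have h0 : μ.real (D ∩ (X₁ ∩ Q)) = 0 :=
        le_antisymm ((measureReal_mono inter_subset_left).trans hD0.le) measureReal_nonneg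
      rw [h0]
      exact add_nonneg measureReal_nonneg (mul_nonneg hδ hquot)
    · have hDpos : 0 < μ.real D := lt_of_le_of_ne measureReal_nonneg (Ne.symm hD0)
      have hchain : μ.real D * μ.real (D ∩ (X₁ ∩ Q)) ≤
          μ.real D * (μ.real (D ∩ (X₂ ∩ Q)) + δ * (μ.real (D ∩ Q) / μ.real D)) := by
        calc μ.real D * μ.real (D ∩ (X₁ ∩ Q))
            ≤ μ.real (D ∩ X₁) * μ.real (D ∩ Q) := h1
          _ ≤ (μ.real (D ∩ X₂) + δ) * μ.real (D ∩ Q) :=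
              mul_le_mul_of_nonneg_right hH measureReal_nonneg
          _ = μ.real (D ∩ X₂) * μ.real (D ∩ Q) + δ * μ.real (D ∩ Q) := by ring
          _ ≤ μ.real D * μ.real (D ∩ (X₂ ∩ Q)) + δ * μ.real (D ∩ Q) := by linarith [h3]
          _ = μ.real D * (μ.real (D ∩ (X₂ ∩ Q)) + δ * (μ.real (D ∩ Q) / μ.real D)) := by
              field_simp
      exact le_of_mul_le_mul_left hchain hDpos
  have hagreeQ : X₁ ∩ Q ∩ Dᶜ = X₂ ∩ Q ∩ Dᶜ := by
    rw [inter_right_comm, hagree, inter_right_comm]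
  calc μ.real (X₁ ∩ Q) = μ.real (X₁ ∩ Q ∩ D) + μ.real (X₁ ∩ Q ∩ Dᶜ) := hsplit _
    _ ≤ μ.real (X₂ ∩ Q ∩ D) + δ * (μ.real (D ∩ Q) / μ.real D) + μ.real (X₂ ∩ Q ∩ Dᶜ) := by
        rw [hagreeQ]
        linarith [hcore]
    _ = μ.real (X₂ ∩ Q) + δ * (μ.real (D ∩ Q) / μ.real D) := by
        rw [hsplit (X₂ ∩ Q)]
        ring

/-- **Joint Lemma 3, sharp error term, event form**: the same for an event `Q` given only through its
monotonicity "`ω ∈ Q`, `C_{a₂}(ω) ⊆ C_{a₂}(ω')`, `C_{a₁}(ω') ⊆ C_{a₁}(ω)` ⟹ `ω' ∈ Q`".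
[cite: KozmaNitzan2024, Lemma 3 (pp. 6–7)] [cite: VandenbergHaggstromKahn2005, Thm. 1.5 (p. 7)] -/
theorem lemma3_joint_event (w : Sym2 V → unitInterval) (a₁ a₂ b : V) (Q : Set (BondConfig V)) {δ : ℝ}
    (hδ : 0 ≤ δ)
    (hQ : ∀ ω ω' : BondConfig V, ω ∈ Q → openEdgeCluster ω a₂ ⊆ openEdgeCluster ω' a₂ →
      openEdgeCluster ω' a₁ ⊆ openEdgeCluster ω a₁ → ω' ∈ Q)
    (h : (prodBernoulli w).real (openConn a₁ b) ≤ (prodBernoulli w).real (openConn a₂ b) + δ) :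
    (prodBernoulli w).real (openConn a₁ b ∩ Q) ≤ (prodBernoulli w).real (openConn a₂ b ∩ Q) +
        δ * ((prodBernoulli w).real ({ω : BondConfig V | ¬ (openGraph ω).Reachable a₂ a₁} ∩ Q) /
            (prodBernoulli w).real {ω : BondConfig V | ¬ (openGraph ω).Reachable a₂ a₁}) := by
  set 𝒬 : Set (Set (Sym2 V) × (Set (Sym2 V))ᵒᵈ) :=
    {CD | ∃ ω ∈ Q, openEdgeCluster ω a₂ ⊆ CD.1 ∧ OrderDual.ofDual CD.2 ⊆ openEdgeCluster ω a₁} with h𝒬def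
  have h𝒬 : IsUpperSet 𝒬 := by
    rintro ⟨C, D⟩ ⟨C', D'⟩ ⟨hCC', hDD'⟩ ⟨ω, hω, hC, hD⟩
    exact ⟨ω, hω, hC.trans hCC', (OrderDual.ofDual_le_ofDual.2 hDD').trans hD⟩
  have hQeq : {ω : BondConfig V | (openEdgeCluster ω a₂, OrderDual.toDual (openEdgeCluster ω a₁)) ∈ 𝒬} = Q := by
    ext ω'
    constructor
    · rintro ⟨ω, hω, hC, hD⟩
      exact hQ ω ω' hω hC hD
    · intro hω'
      exact ⟨ω', hω', subset_rfl, subset_rfl⟩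
  have key := lemma3_joint_sharp w a₁ a₂ b hδ h h𝒬
  rw [hQeq] at key
  exact key

end JointLemma3

end Summit.CriticalPhenomena.PercolationContinuityZ3.Theorems

end
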